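import Mathlib
import HarnessLib
import Summits.AtomisticToContinuum.Crystallization.Theorems.PricedLinkCensusSoftFourRingsPathFamily

/-!
# Soft four-rings: position and closure lemmas (bond-set level)

Support file for `SoftFourRings` (route `PricedLinkCensus`, sub-problem `Crystallization`).

* `fan_paths_eq` : two path presentations `x 0 – x 1 – x 2 – x 3` and `y 0 – y 1 – y 2 – y 3` of the
  same neighbourhood `N(v)` (with the chords of the first outside `B`) agree up to reversal;
* `false_of_closed` : in a `4`-regular bond structure on `12` points, no `N`-closed set `W` has
  `8 ≤ |W| ≤ 10`;
* `block_swap` : the symmetry `a ↔ b`, `p ↔ q`, `u ↔ u'`, `m ↔ m'` of the block data produced by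
  `slack_block` (without the bond-triangle counts);
* `or4_rev`, `or4_perm1`, `or4_perm2` : permutations of four-fold disjunctions.
-/

namespace Summit.AtomisticToContinuum.Crystallization.Theorems

open Real RealInnerProductSpace Literature.Geometry.DiscreteGeometry

/-- Reversal of a four-fold disjunction of equalities. -/
theorem or4_rev {α : Type*} {y a b c d : α} :
    (y = a ∨ y = b ∨ y = c ∨ y = d) ↔ (y = d ∨ y = c ∨ y = b ∨ y = a) := by
  tauto

/-- A permutation of a four-fold disjunction of equalities (first to third place). -/
theorem or4_perm1 {α : Type*} {y a b c d : α} :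
    (y = a ∨ y = b ∨ y = c ∨ y = d) ↔ (y = b ∨ y = c ∨ y = a ∨ y = d) := by
  tauto

/-- A permutation of a four-fold disjunction of equalities (`(a,b,c,d) ↦ (c,b,d,a)`). -/
theorem or4_perm2 {α : Type*} {y a b c d : α} :
    (y = a ∨ y = b ∨ y = c ∨ y = d) ↔ (y = c ∨ y = b ∨ y = d ∨ y = a) := by
  tauto

section Setting

variable {X : Finset (EuclideanSpace ℝ (Fin 3))} {B : Finset (Finset (EuclideanSpace ℝ (Fin 3)))}
  (hB : ∀ T ∈ B, ∃ u ∈ X, ∃ u' ∈ X, u ≠ u' ∧ 1 - (101 / 100 : ℝ) ^ 2 / 2 ≤ ⟪u, u'⟫ ∧ T = {u, u'})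

include hB in
/-- **Position lemma.**  If `N(v) = {x₀, x₁, x₂, x₃} = {y₀, y₁, y₂, y₃}` where `x₀–x₁–x₂–x₃` is a
path of bonds whose three chords are not bonds, and `y₀–y₁–y₂–y₃` is a path of bonds with
`y₀ ≠ y₂`, `y₁ ≠ y₃`, `y₁ ≠ y₂`, then `y = x` or `y` is `x` reversed. -/
theorem fan_paths_eq {v x₀ x₁ x₂ x₃ y₀ y₁ y₂ y₃ : EuclideanSpace ℝ (Fin 3)}
    (hNx : ∀ z, ({v, z} : Finset (EuclideanSpace ℝ (Fin 3))) ∈ B ↔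
      (z = x₀ ∨ z = x₁ ∨ z = x₂ ∨ z = x₃))
    (hNy : ∀ z, ({v, z} : Finset (EuclideanSpace ℝ (Fin 3))) ∈ B ↔
      (z = y₀ ∨ z = y₁ ∨ z = y₂ ∨ z = y₃))
    (hx01 : ({x₀, x₁} : Finset (EuclideanSpace ℝ (Fin 3))) ∈ B)
    (hx12 : ({x₁, x₂} : Finset (EuclideanSpace ℝ (Fin 3))) ∈ B)
    (hx23 : ({x₂, x₃} : Finset (EuclideanSpace ℝ (Fin 3))) ∈ B)
    (hx02 : ({x₀, x₂} : Finset (EuclideanSpace ℝ (Fin 3))) ∉ B)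
    (hx13 : ({x₁, x₃} : Finset (EuclideanSpace ℝ (Fin 3))) ∉ B)
    (hx03 : ({x₀, x₃} : Finset (EuclideanSpace ℝ (Fin 3))) ∉ B)
    (hy01 : ({y₀, y₁} : Finset (EuclideanSpace ℝ (Fin 3))) ∈ B)
    (hy12 : ({y₁, y₂} : Finset (EuclideanSpace ℝ (Fin 3))) ∈ B)
    (hy23 : ({y₂, y₃} : Finset (EuclideanSpace ℝ (Fin 3))) ∈ B)
    (hy02 : y₀ ≠ y₂) (hy13 : y₁ ≠ y₃) (hy12' : y₁ ≠ y₂) :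
    (y₀ = x₀ ∧ y₁ = x₁ ∧ y₂ = x₂ ∧ y₃ = x₃) ∨ (y₀ = x₃ ∧ y₁ = x₂ ∧ y₂ = x₁ ∧ y₃ = x₀) := by
  have hself : ∀ z : EuclideanSpace ℝ (Fin 3), ({z, z} : Finset (EuclideanSpace ℝ (Fin 3))) ∉ B :=
    fun z h => ne_of_mem_bonds hB h rfl
  have hmemN : ∀ z, (z = y₀ ∨ z = y₁ ∨ z = y₂ ∨ z = y₃) → (z = x₀ ∨ z = x₁ ∨ z = x₂ ∨ z = x₃) :=
    fun z hz => (hNx z).1 ((hNy z).2 hz)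
  have hY0 := hmemN y₀ (Or.inl rfl)
  have hY1 := hmemN y₁ (Or.inr (Or.inl rfl))
  have hY2 := hmemN y₂ (Or.inr (Or.inr (Or.inl rfl)))
  have hY3 := hmemN y₃ (Or.inr (Or.inr (Or.inr rfl)))
  -- partners inside `N(v)` of each `x_k`
  have hP0 : ∀ z, (z = x₀ ∨ z = x₁ ∨ z = x₂ ∨ z = x₃) →
      ({x₀, z} : Finset (EuclideanSpace ℝ (Fin 3))) ∈ B → z = x₁ := by
    rintro z (rfl | rfl | rfl | rfl) h
    exacts [(hself _ h).elim, rfl, (hx02 h).elim, (hx03 h).elim]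
  have hP3 : ∀ z, (z = x₀ ∨ z = x₁ ∨ z = x₂ ∨ z = x₃) →
      ({x₃, z} : Finset (EuclideanSpace ℝ (Fin 3))) ∈ B → z = x₂ := by
    rintro z (rfl | rfl | rfl | rfl) h
    · exact (hx03 (by rw [Finset.pair_comm]; exact h)).elim
    · exact (hx13 (by rw [Finset.pair_comm]; exact h)).elim
    · rfl
    · exact (hself _ h).elim
  have hP1 : ∀ z, (z = x₀ ∨ z = x₁ ∨ z = x₂ ∨ z = x₃) →
      ({x₁, z} : Finset (EuclideanSpace ℝ (Fin 3))) ∈ B → z = x₀ ∨ z = x₂ := by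
    rintro z (rfl | rfl | rfl | rfl) h
    exacts [Or.inl rfl, (hself _ h).elim, Or.inr rfl, (hx13 h).elim]
  have hP2 : ∀ z, (z = x₀ ∨ z = x₁ ∨ z = x₂ ∨ z = x₃) →
      ({x₂, z} : Finset (EuclideanSpace ℝ (Fin 3))) ∈ B → z = x₁ ∨ z = x₃ := by
    rintro z (rfl | rfl | rfl | rfl) h
    · exact (hx02 (by rw [Finset.pair_comm]; exact h)).elim
    · exact Or.inl rfl
    · exact (hself _ h).elim
    · exact Or.inr rfl
  have hy10 : ({y₁, y₀} : Finset (EuclideanSpace ℝ (Fin 3))) ∈ B := by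
    rw [Finset.pair_comm]; exact hy01
  have hy21 : ({y₂, y₁} : Finset (EuclideanSpace ℝ (Fin 3))) ∈ B := by
    rw [Finset.pair_comm]; exact hy12
  -- the middles `y₁, y₂` are among `x₁, x₂`
  have hmid1 : y₁ = x₁ ∨ y₁ = x₂ := by
    rcases hY1 with e | e | e | e
    · exfalso
      rw [e] at hy10 hy12
      exact hy02 ((hP0 _ hY0 hy10).trans (hP0 _ hY2 hy12).symm)
    · exact Or.inl e
    · exact Or.inr e
    · exfalso
      rw [e] at hy10 hy12
      exact hy02 ((hP3 _ hY0 hy10).trans (hP3 _ hY2 hy12).symm)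
  have hmid2 : y₂ = x₁ ∨ y₂ = x₂ := by
    rcases hY2 with e | e | e | e
    · exfalso
      rw [e] at hy21 hy23
      exact hy13 ((hP0 _ hY1 hy21).trans (hP0 _ hY3 hy23).symm)
    · exact Or.inl e
    · exact Or.inr e
    · exfalso
      rw [e] at hy21 hy23
      exact hy13 ((hP3 _ hY1 hy21).trans (hP3 _ hY3 hy23).symm)
  have hy01ne : y₀ ≠ y₁ := fun h => hself y₁ (h ▸ hy01)
  have hy23ne : y₂ ≠ y₃ := fun h => hself y₃ (h ▸ hy23)
  rcases hmid1 with e1 | e1 <;> rcases hmid2 with e2 | e2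
  · exact absurd (e1.trans e2.symm) hy12'
  · left
    refine ⟨?_, e1, e2, ?_⟩
    · rw [e1] at hy10
      rcases hP1 _ hY0 hy10 with e | e
      · exact e
      · exact absurd (e.trans e2.symm) hy02
    · rw [e2] at hy23
      rcases hP2 _ hY3 hy23 with e | e
      · exact absurd (e1.trans e.symm) hy13
      · exact e
  · right
    refine ⟨?_, e1, e2, ?_⟩
    · rw [e1] at hy10
      rcases hP2 _ hY0 hy10 with e | e
      · exact absurd (e.trans e2.symm) hy02
      · exact e
    · rw [e2] at hy23
      rcases hP1 _ hY3 hy23 with e | e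
      · exact e
      · exact absurd (e1.trans e.symm) hy13
  · exact absurd (e1.trans e2.symm) hy12'

variable (hcard : X.card = 12)
  (hdeg : ∀ v ∈ X, ∃ w : Fin 4 → EuclideanSpace ℝ (Fin 3), (∀ k, w k ∈ X) ∧
    Function.Injective w ∧ (∀ k, w k ≠ v) ∧
    (∀ k, ({v, w k} : Finset (EuclideanSpace ℝ (Fin 3))) ∈ B) ∧
    ∀ y, ({v, y} : Finset (EuclideanSpace ℝ (Fin 3))) ∈ B → ∃ k, y = w k)

include hcard hdeg in
/-- **Closure lemma.**  In the `4`-regular bond structure on the `12` points of `X`, a set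
`W ⊆ X` closed under taking bond partners cannot have `8 ≤ |W| ≤ 10`: a vertex outside `W` and
its four partners would be five points outside `W`. -/
theorem false_of_closed (W : Finset (EuclideanSpace ℝ (Fin 3))) (hWX : W ⊆ X) (hW8 : 8 ≤ W.card)
    (hW10 : W.card ≤ 10)
    (hclosed : ∀ w ∈ W, ∀ z, ({w, z} : Finset (EuclideanSpace ℝ (Fin 3))) ∈ B → z ∈ W) :
    False := by
  classical
  have hsd : (X \ W).card = 12 - W.card := by rw [Finset.card_sdiff_of_subset hWX, hcard]
  obtain ⟨z, hz⟩ : (X \ W).Nonempty := by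
    rw [← Finset.card_pos, hsd]; omega
  rw [Finset.mem_sdiff] at hz
  obtain ⟨w, hwX, hwinj, hwz, hzw, -⟩ := hdeg z hz.1
  have hwW : ∀ k, w k ∉ W := fun k hk =>
    hz.2 (hclosed (w k) hk z (by rw [Finset.pair_comm]; exact hzw k))
  have hsub : insert z (Finset.univ.image w) ⊆ X \ W := by
    intro y hy
    rw [Finset.mem_insert, Finset.mem_image] at hy
    rw [Finset.mem_sdiff]
    rcases hy with rfl | ⟨k, -, rfl⟩
    · exact hz
    · exact ⟨hwX k, hwW k⟩
  have hzim : z ∉ Finset.univ.image w := by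
    rw [Finset.mem_image]
    rintro ⟨k, -, hk⟩
    exact hwz k hk
  have h5 : (insert z (Finset.univ.image w)).card = 5 := by
    rw [Finset.card_insert_of_notMem hzim, Finset.card_image_of_injective _ hwinj,
      Finset.card_univ, Fintype.card_fin]
  have := Finset.card_le_card hsub
  rw [h5, hsd] at this
  omega

/-- **Block symmetry**: the block data is invariant under `a ↔ b`, `p ↔ q`, `u ↔ u'`,
`m ↔ m'`. -/
theorem block_swap {a b c p q u w m n r : EuclideanSpace ℝ (Fin 3)}
    (h : ((p ∈ X ∧ q ∈ X ∧ u ∈ X ∧ w ∈ X ∧ m ∈ X ∧ n ∈ X ∧ r ∈ X) ∧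
      (∀ y, ({a, y} : Finset (EuclideanSpace ℝ (Fin 3))) ∈ B ↔ (y = p ∨ y = u ∨ y = r ∨ y = b)) ∧
      (∀ y, ({b, y} : Finset (EuclideanSpace ℝ (Fin 3))) ∈ B ↔ (y = q ∨ y = w ∨ y = r ∨ y = a)) ∧
      (∀ y, ({c, y} : Finset (EuclideanSpace ℝ (Fin 3))) ∈ B ↔ (y = p ∨ y = n ∨ y = m ∨ y = q)) ∧
      (∀ y, ({r, y} : Finset (EuclideanSpace ℝ (Fin 3))) ∈ B ↔ (y = u ∨ y = a ∨ y = b ∨ y = w)) ∧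
      (({p, u} : Finset (EuclideanSpace ℝ (Fin 3))) ∈ B ∧
        ({u, r} : Finset (EuclideanSpace ℝ (Fin 3))) ∈ B ∧
        ({r, b} : Finset (EuclideanSpace ℝ (Fin 3))) ∈ B ∧
        ({q, w} : Finset (EuclideanSpace ℝ (Fin 3))) ∈ B ∧
        ({w, r} : Finset (EuclideanSpace ℝ (Fin 3))) ∈ B ∧
        ({p, n} : Finset (EuclideanSpace ℝ (Fin 3))) ∈ B ∧
        ({n, m} : Finset (EuclideanSpace ℝ (Fin 3))) ∈ B ∧
        ({m, q} : Finset (EuclideanSpace ℝ (Fin 3))) ∈ B) ∧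
      (({p, r} : Finset (EuclideanSpace ℝ (Fin 3))) ∉ B ∧
        ({u, b} : Finset (EuclideanSpace ℝ (Fin 3))) ∉ B ∧
        ({p, b} : Finset (EuclideanSpace ℝ (Fin 3))) ∉ B ∧
        ({q, r} : Finset (EuclideanSpace ℝ (Fin 3))) ∉ B ∧
        ({w, a} : Finset (EuclideanSpace ℝ (Fin 3))) ∉ B ∧
        ({q, a} : Finset (EuclideanSpace ℝ (Fin 3))) ∉ B ∧
        ({p, m} : Finset (EuclideanSpace ℝ (Fin 3))) ∉ B ∧
        ({n, q} : Finset (EuclideanSpace ℝ (Fin 3))) ∉ B ∧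
        ({p, q} : Finset (EuclideanSpace ℝ (Fin 3))) ∉ B ∧
        ({u, w} : Finset (EuclideanSpace ℝ (Fin 3))) ∉ B) ∧
      ((p ≠ u ∧ p ≠ r ∧ p ≠ b ∧ u ≠ r ∧ u ≠ b ∧ r ≠ b) ∧
        (q ≠ w ∧ q ≠ r ∧ q ≠ a ∧ w ≠ r ∧ w ≠ a ∧ r ≠ a) ∧
        (p ≠ n ∧ p ≠ m ∧ p ≠ q ∧ n ≠ m ∧ n ≠ q ∧ m ≠ q) ∧
        (u ≠ a ∧ u ≠ b ∧ u ≠ w ∧ a ≠ b ∧ a ≠ w ∧ b ≠ w) ∧ r ≠ c) ∧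
      (∀ y, ({p, y} : Finset (EuclideanSpace ℝ (Fin 3))) ∈ B ↔ (y = a ∨ y = u ∨ y = c ∨ y = n)) ∧
      (∀ y, ({q, y} : Finset (EuclideanSpace ℝ (Fin 3))) ∈ B ↔ (y = b ∨ y = w ∨ y = c ∨ y = m)))) :
    ((q ∈ X ∧ p ∈ X ∧ w ∈ X ∧ u ∈ X ∧ n ∈ X ∧ m ∈ X ∧ r ∈ X) ∧
    (∀ y, ({b, y} : Finset (EuclideanSpace ℝ (Fin 3))) ∈ B ↔ (y = q ∨ y = w ∨ y = r ∨ y = a)) ∧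
    (∀ y, ({a, y} : Finset (EuclideanSpace ℝ (Fin 3))) ∈ B ↔ (y = p ∨ y = u ∨ y = r ∨ y = b)) ∧
    (∀ y, ({c, y} : Finset (EuclideanSpace ℝ (Fin 3))) ∈ B ↔ (y = q ∨ y = m ∨ y = n ∨ y = p)) ∧
    (∀ y, ({r, y} : Finset (EuclideanSpace ℝ (Fin 3))) ∈ B ↔ (y = w ∨ y = b ∨ y = a ∨ y = u)) ∧
    (({q, w} : Finset (EuclideanSpace ℝ (Fin 3))) ∈ B ∧
      ({w, r} : Finset (EuclideanSpace ℝ (Fin 3))) ∈ B ∧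
      ({r, a} : Finset (EuclideanSpace ℝ (Fin 3))) ∈ B ∧
      ({p, u} : Finset (EuclideanSpace ℝ (Fin 3))) ∈ B ∧
      ({u, r} : Finset (EuclideanSpace ℝ (Fin 3))) ∈ B ∧
      ({q, m} : Finset (EuclideanSpace ℝ (Fin 3))) ∈ B ∧
      ({m, n} : Finset (EuclideanSpace ℝ (Fin 3))) ∈ B ∧
      ({n, p} : Finset (EuclideanSpace ℝ (Fin 3))) ∈ B) ∧
    (({q, r} : Finset (EuclideanSpace ℝ (Fin 3))) ∉ B ∧
      ({w, a} : Finset (EuclideanSpace ℝ (Fin 3))) ∉ B ∧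
      ({q, a} : Finset (EuclideanSpace ℝ (Fin 3))) ∉ B ∧
      ({p, r} : Finset (EuclideanSpace ℝ (Fin 3))) ∉ B ∧
      ({u, b} : Finset (EuclideanSpace ℝ (Fin 3))) ∉ B ∧
      ({p, b} : Finset (EuclideanSpace ℝ (Fin 3))) ∉ B ∧
      ({q, n} : Finset (EuclideanSpace ℝ (Fin 3))) ∉ B ∧
      ({m, p} : Finset (EuclideanSpace ℝ (Fin 3))) ∉ B ∧
      ({q, p} : Finset (EuclideanSpace ℝ (Fin 3))) ∉ B ∧
      ({w, u} : Finset (EuclideanSpace ℝ (Fin 3))) ∉ B) ∧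
    ((q ≠ w ∧ q ≠ r ∧ q ≠ a ∧ w ≠ r ∧ w ≠ a ∧ r ≠ a) ∧
      (p ≠ u ∧ p ≠ r ∧ p ≠ b ∧ u ≠ r ∧ u ≠ b ∧ r ≠ b) ∧
      (q ≠ m ∧ q ≠ n ∧ q ≠ p ∧ m ≠ n ∧ m ≠ p ∧ n ≠ p) ∧
      (w ≠ b ∧ w ≠ a ∧ w ≠ u ∧ b ≠ a ∧ b ≠ u ∧ a ≠ u) ∧ r ≠ c) ∧
    (∀ y, ({q, y} : Finset (EuclideanSpace ℝ (Fin 3))) ∈ B ↔ (y = b ∨ y = w ∨ y = c ∨ y = m)) ∧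
    (∀ y, ({p, y} : Finset (EuclideanSpace ℝ (Fin 3))) ∈ B ↔ (y = a ∨ y = u ∨ y = c ∨ y = n))) := by
  obtain ⟨⟨hp1X, hq1X, hu1X, hw1X, hm1X, hn1X, hr1X⟩, hNa1, hNb1, hNc1, hNr1,
    ⟨hBpu1, hBur1, hBrb1, hBqw1, hBwr1, hBpn1, hBnm1, hBmq1⟩,
    ⟨hBpr1, hBub1, hBpb1, hBqr1, hBwa1, hBqa1, hBpm1, hBnq1, hBpq1, hBuw1⟩,
    ⟨⟨hpu1, hpr1, hpb1, hur1, hub1, hrb1⟩, ⟨hqw1, hqr1, hqa1, hwr1, hwa1, hra1⟩,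
      ⟨hpn1, hpm1, hpq1, hnm1, hnq1, hmq1⟩, ⟨hua1, hub'1, huw1, hab1, haw1, hbw1⟩, hrc1⟩,
    hNp1, hNq1⟩ := h
  refine ⟨⟨hq1X, hp1X, hw1X, hu1X, hn1X, hm1X, hr1X⟩, hNb1, hNa1, fun y => (hNc1 y).trans or4_rev,
    fun y => (hNr1 y).trans or4_rev, ⟨hBqw1, hBwr1, ?_, hBpu1, hBur1, ?_, ?_, ?_⟩,
    ⟨hBqr1, hBwa1, hBqa1, hBpr1, hBub1, hBpb1, ?_, ?_, ?_, ?_⟩,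
    ⟨⟨hqw1, hqr1, hqa1, hwr1, hwa1, hra1⟩, ⟨hpu1, hpr1, hpb1, hur1, hub1, hrb1⟩,
      ⟨hmq1.symm, hnq1.symm, hpq1.symm, hnm1.symm, hpm1.symm, hpn1.symm⟩,
      ⟨hbw1.symm, haw1.symm, huw1.symm, hab1.symm, hub'1.symm, hua1.symm⟩, hrc1⟩, hNq1, hNp1⟩
  · rw [Finset.pair_comm]; exact (hNa1 r).2 (Or.inr (Or.inr (Or.inl rfl)))
  · rw [Finset.pair_comm]; exact hBmq1
  · rw [Finset.pair_comm]; exact hBnm1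
  · rw [Finset.pair_comm]; exact hBpn1
  · rw [Finset.pair_comm]; exact hBnq1
  · rw [Finset.pair_comm]; exact hBpm1
  · rw [Finset.pair_comm]; exact hBpq1
  · rw [Finset.pair_comm]; exact hBuw1

end Setting

end Summit.AtomisticToContinuum.Crystallization.Theorems
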